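import Summits.Ventures.QEC.CircuitDistance.SyndromeCycle
import HarnessLib

/-!
# P3-PORT (A1): cycle semantics of the SM circuit — `𝔽₂`-structure of states, fault-free evolution, the affine structure of
# `simulate`, linearity in the injected Pauli, events of the circuit (cell `qec`, experiment CDX, seat qec-cdx-type-1)

Everything here is generic in the circuit data `S : SMCode ℓ m` and proved from the definitions of `SyndromeCycle.lean`
(`applyEv`, `inject`, `simulate`); no table, no `decide`.
* `State.add` and its laws; `applyEv_add`/`applyEv_init` (ideal operations are linear and fix the all-clear state);
* `evolve` (fault-free run), `delta` (the injected vector), `inject_eq_add`, `simulate_eq_evolve_add` (affine structure),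
  `simulate_init_add` (linearity in the injected Pauli at a fixed operation — the basis of the merge lemma);
* `Fault.cyc`, `Fault.retag`, `Ev.cyc`, `Ev.retag`, `mem_cycleEvents_iff`, `mem_allEvents_iff`, `allEvents_succ`;
* frame accessors `Frame.dataXb`, `Frame.dataZb`, `Frame.ancZx` and `toZ2`.
Nothing here asserts a value of `d_circ`.
-/

namespace Summit.Ventures.QEC.CircuitDistance

open Literature.InformationTheory.QuantumCodes

variable {ℓ m : ℕ}

/-! ## `𝔽₂`-structure of Pauli frames and states -/

/-- Pointwise product (XOR) of two states: frames multiply qubit-wise, outcome flips add. -/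
def State.add (s t : State ℓ m) : State ℓ m :=
  ⟨fun q => P1.mul (s.frame q) (t.frame q), fun c i => xor (s.mX c i) (t.mX c i), fun c i => xor (s.mZ c i) (t.mZ c i)⟩

/-- Extensionality for states. -/
theorem State.ext' {s t : State ℓ m} (h₁ : s.frame = t.frame) (h₂ : s.mX = t.mX) (h₃ : s.mZ = t.mZ) : s = t := by
  cases s; cases t; cases h₁; cases h₂; cases h₃; rfl

/-- `P1.mul` unfolded. -/
theorem P1.mul_def (p q : P1) : P1.mul p q = (xor p.1 q.1, xor p.2 q.2) := rfl

/-- `State.add` is commutative. -/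
theorem State.add_comm (s t : State ℓ m) : s.add t = t.add s := by
  apply State.ext' <;> funext <;> simp [State.add, P1.mul_def, Bool.xor_comm]

/-- `State.add` is associative. -/
theorem State.add_assoc (s t u : State ℓ m) : (s.add t).add u = s.add (t.add u) := by
  apply State.ext' <;> funext <;> simp [State.add, P1.mul_def]

/-- `State.init` is a right zero of `State.add`. -/
theorem State.add_init (s : State ℓ m) : s.add State.init = s := by
  apply State.ext' <;> funext <;> simp [State.add, P1.mul_def, State.init]

/-- `State.init` is a left zero of `State.add`. -/
theorem State.init_add (s : State ℓ m) : State.init.add s = s := by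
  rw [State.add_comm]; exact State.add_init s

/-- Every state is its own inverse. -/
theorem State.add_self (s : State ℓ m) : s.add s = State.init := by
  apply State.ext' <;> funext <;> simp [State.add, P1.mul_def, State.init]

/-- Left-commutativity of `State.add`. -/
theorem State.add_left_comm (s t u : State ℓ m) : s.add (t.add u) = t.add (s.add u) := by
  rw [← State.add_assoc, State.add_comm s t, State.add_assoc]

/-- The cycle index of a fault. -/
def Fault.cyc : Fault ℓ m → ℕ
  | .cnot c _ _ _ _ => c | .idle c _ _ _ => c | .initX c _ => c | .initZ c _ => c | .measX c _ => c | .measZ c _ => c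

/-- The same fault moved to cycle `c'`. -/
def Fault.retag (c' : ℕ) : Fault ℓ m → Fault ℓ m
  | .cnot _ lay i pc pt => .cnot c' lay i pc pt | .idle _ s i p => .idle c' s i p | .initX _ i => .initX c' i
  | .initZ _ i => .initZ c' i | .measX _ i => .measX c' i | .measZ _ i => .measZ c' i

/-- The cycle tag of an event. -/
def Ev.cyc : Ev → ℕ
  | .initX c => c | .initZ c => c | .measX c => c | .measZ c => c | .cnot c _ => c | .idle c _ => c

/-- The same event moved to cycle `c'`. -/
def Ev.retag (c' : ℕ) : Ev → Ev
  | .initX _ => .initX c' | .initZ _ => .initZ c' | .measX _ => .measX c' | .measZ _ => .measZ c'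
  | .cnot _ lay => .cnot c' lay | .idle _ s => .idle c' s

/-- The `x`-bits of the data registers of a frame (left block `q(L)`, right block `q(R)`) over the code's column index
`Mono ⊕ Mono` — the support of the `X`-type data error. -/
def Frame.dataXb (F : Frame ℓ m) : BB.Mono ℓ m ⊕ BB.Mono ℓ m → Bool :=
  fun q => (F (q.elim (fun i => (Reg.L, i)) fun i => (Reg.R, i))).1

/-- The `z`-bits of the data registers of a frame — the support of the `Z`-type data error. -/
def Frame.dataZb (F : Frame ℓ m) : BB.Mono ℓ m ⊕ BB.Mono ℓ m → Bool :=
  fun q => (F (q.elim (fun i => (Reg.L, i)) fun i => (Reg.R, i))).2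

/-- The `x`-bits of the `Z`-check ancilla register (`ζ`: an `X` left on a freshly re-initialised `Z`-ancilla by an
`InitZ` fault). -/
def Frame.ancZx (F : Frame ℓ m) : BB.Mono ℓ m → Bool := fun j => (F (Reg.Z, j)).1

/-- Boolean vector ↦ `𝔽₂`-vector. -/
def toZ2 {α : Type*} (b : α → Bool) : α → ZMod 2 := fun q => if b q then 1 else 0

/-- `toZ2` of one Boolean. -/
theorem toZ2_apply {α : Type*} (b : α → Bool) (q : α) : toZ2 b q = if b q then 1 else 0 := rfl

/-- `toZ2` turns `xor` into `+`. -/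
theorem toZ2_xor {α : Type*} (a b : α → Bool) : toZ2 (fun q => xor (a q) (b q)) = toZ2 a + toZ2 b := by
  funext q
  rw [Pi.add_apply, toZ2_apply, toZ2_apply, toZ2_apply]
  cases a q <;> cases b q <;> decide

variable [NeZero ℓ] [NeZero m]

/-! ## Fault-free evolution, injected vectors, affine structure of `simulate` -/

/-- Fault-free evolution of a state through a list of events. -/
def evolve (S : SMCode ℓ m) (es : List Ev) (st : State ℓ m) : State ℓ m :=
  es.foldl (fun st e => applyEv S e st) st

/-- The vector a fault injects (its Pauli on the all-clear frame, or its outcome flip). -/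
def delta (S : SMCode ℓ m) (f : Fault ℓ m) : State ℓ m := inject S f State.init

/-- `evolve` through no event. -/
@[simp] theorem evolve_nil (S : SMCode ℓ m) (st : State ℓ m) : evolve S [] st = st := rfl

/-- `evolve` through a first event. -/
@[simp] theorem evolve_cons (S : SMCode ℓ m) (e : Ev) (es : List Ev) (st : State ℓ m) :
    evolve S (e :: es) st = evolve S es (applyEv S e st) := rfl

/-- `evolve` through a concatenation. -/
theorem evolve_append (S : SMCode ℓ m) (es es' : List Ev) (st : State ℓ m) :
    evolve S (es ++ es') st = evolve S es' (evolve S es st) := by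
  unfold evolve; rw [List.foldl_append]

/-- Ideal operations fix the all-clear state. -/
theorem applyEv_init (S : SMCode ℓ m) (e : Ev) : applyEv S e State.init = State.init := by
  cases e <;> apply State.ext' <;> funext q <;>
    simp [applyEv, State.init, Frame.cnotLayer, Frame.clearReg]

/-- Ideal operations are `𝔽₂`-linear on states. -/
theorem applyEv_add (S : SMCode ℓ m) (e : Ev) (s t : State ℓ m) :
    applyEv S e (s.add t) = (applyEv S e s).add (applyEv S e t) := by
  cases e <;>
    refine State.ext' (funext fun q => ?_) (funext fun a => funext fun b => ?_) (funext fun a => funext fun b => ?_) <;>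
    simp only [applyEv, State.add, Frame.cnotLayer, Frame.clearReg, P1.mul_def] <;> (try split_ifs) <;>
    simp [Bool.xor_left_comm]

/-- Fault-free evolution is `𝔽₂`-linear. -/
theorem evolve_add (S : SMCode ℓ m) (es : List Ev) (s t : State ℓ m) :
    evolve S es (s.add t) = (evolve S es s).add (evolve S es t) := by
  induction es generalizing s t with
  | nil => rfl
  | cons e es ih => simp only [evolve_cons, applyEv_add, ih]

/-- Fault-free evolution fixes the all-clear state. -/
theorem evolve_init (S : SMCode ℓ m) (es : List Ev) : evolve S es State.init = State.init := by
  induction es with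
  | nil => rfl
  | cons e es ih => simp only [evolve_cons, applyEv_init, ih]

/-- Injecting a fault adds its vector. -/
theorem inject_eq_add (S : SMCode ℓ m) (f : Fault ℓ m) (st : State ℓ m) : inject S f st = st.add (delta S f) := by
  cases f <;>
    refine State.ext' (funext fun q => ?_) (funext fun a => funext fun b => ?_) (funext fun a => funext fun b => ?_) <;>
    simp only [inject, delta, State.add, State.init, Frame.mulAt, P1.mul_def] <;> (try split_ifs) <;> simp_all

/-- `simulate` through no event. -/
@[simp] theorem simulate_nil (S : SMCode ℓ m) (f : Fault ℓ m) (st : State ℓ m) : simulate S f [] st = st := rfl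

/-- `simulate` through a first event. -/
theorem simulate_cons (S : SMCode ℓ m) (f : Fault ℓ m) (e : Ev) (es : List Ev) (st : State ℓ m) :
    simulate S f (e :: es) st =
      simulate S f es (if e = f.ev then inject S f (applyEv S e st) else applyEv S e st) := rfl

/-- A fault whose event does not occur does nothing. -/
theorem simulate_of_not_mem (S : SMCode ℓ m) (f : Fault ℓ m) {es : List Ev} (h : f.ev ∉ es) (st : State ℓ m) :
    simulate S f es st = evolve S es st := by
  induction es generalizing st with
  | nil => rfl
  | cons e es ih =>
    have hne : e ≠ f.ev := fun he => h (he ▸ List.mem_cons_self)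
    have h' : f.ev ∉ es := fun hm => h (List.mem_cons_of_mem _ hm)
    rw [simulate_cons, if_neg hne, evolve_cons, ih h']

/-- `simulate` over a concatenation. -/
theorem simulate_append (S : SMCode ℓ m) (f : Fault ℓ m) (es es' : List Ev) (st : State ℓ m) :
    simulate S f (es ++ es') st = simulate S f es' (simulate S f es st) := by
  induction es generalizing st with
  | nil => rfl
  | cons e es ih => rw [List.cons_append, simulate_cons, simulate_cons, ih]

/-- Affine structure: the faulty run from `st` is the fault-free run from `st` plus the faulty run from all-clear. -/
theorem simulate_eq_evolve_add (S : SMCode ℓ m) (f : Fault ℓ m) (es : List Ev) (st : State ℓ m) :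
    simulate S f es st = (evolve S es st).add (simulate S f es State.init) := by
  induction es generalizing st with
  | nil => simp [State.add_init]
  | cons e es ih =>
    rw [simulate_cons, simulate_cons, evolve_cons, applyEv_init, ih]
    conv_rhs => rw [ih]
    by_cases he : e = f.ev
    · rw [if_pos he, if_pos he, inject_eq_add, inject_eq_add, State.init_add, evolve_add, State.add_assoc]
    · rw [if_neg he, if_neg he, evolve_init, State.init_add]

/-- Linearity in the injected vector at a fixed event: the effect of a product of Paulis on one operation is the
sum of the effects (the basis of the MERGE lemma `faultCount` ↔ cardinality). -/
theorem simulate_init_add (S : SMCode ℓ m) {f f₁ f₂ : Fault ℓ m} (h₁ : f₁.ev = f.ev) (h₂ : f₂.ev = f.ev)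
    (hδ : delta S f = (delta S f₁).add (delta S f₂)) (es : List Ev) :
    simulate S f es State.init = (simulate S f₁ es State.init).add (simulate S f₂ es State.init) := by
  induction es with
  | nil => simp [State.add_init]
  | cons e es ih =>
    rw [simulate_cons, simulate_cons, simulate_cons, applyEv_init, h₁, h₂]
    by_cases he : e = f.ev
    · rw [if_pos he, if_pos he, if_pos he]
      rw [simulate_eq_evolve_add S f, simulate_eq_evolve_add S f₁ es, simulate_eq_evolve_add S f₂ es, ih]
      rw [inject_eq_add, inject_eq_add, inject_eq_add, State.init_add, State.init_add, State.init_add, hδ, evolve_add]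
      -- AC rearrangement
      rw [State.add_assoc, State.add_assoc, ← State.add_assoc (evolve S es (delta S f₂)),
        State.add_comm (evolve S es (delta S f₂)) (simulate S f₁ es State.init), State.add_assoc]
    · rw [if_neg he, if_neg he, if_neg he, ih]

/-! ## Events of the circuit -/

omit [NeZero ℓ] [NeZero m] in
/-- The events of cycle `c` are exactly the events tagged `c`. -/
theorem mem_cycleEvents_iff (c : ℕ) (e : Ev) : e ∈ cycleEvents c ↔ e.cyc = c := by
  cases e with
  | initX c' => simp [cycleEvents, Ev.cyc, eq_comm]
  | initZ c' => simp [cycleEvents, Ev.cyc, eq_comm]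
  | measX c' => simp [cycleEvents, Ev.cyc, eq_comm]
  | measZ c' => simp [cycleEvents, Ev.cyc, eq_comm]
  | cnot c' lay => cases lay <;> simp [cycleEvents, Ev.cyc, eq_comm]
  | idle c' s => cases s <;> simp [cycleEvents, Ev.cyc, eq_comm]

omit [NeZero ℓ] [NeZero m] in
/-- An event belongs to the `Nc`-cycle circuit iff its cycle tag is in `1 … Nc`. -/
theorem mem_allEvents_iff (Nc : ℕ) (e : Ev) : e ∈ allEvents Nc ↔ 1 ≤ e.cyc ∧ e.cyc ≤ Nc := by
  unfold allEvents
  rw [List.mem_flatMap]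
  simp only [List.mem_range, mem_cycleEvents_iff]
  constructor
  · rintro ⟨c, hc, he⟩; omega
  · rintro ⟨h1, h2⟩; exact ⟨e.cyc - 1, by omega, by omega⟩

omit [NeZero ℓ] [NeZero m] in
/-- `allEvents` grows by whole cycles. -/
theorem allEvents_succ (Nc : ℕ) : allEvents (Nc + 1) = allEvents Nc ++ cycleEvents (Nc + 1) := by
  unfold allEvents
  rw [List.range_succ, List.flatMap_append]
  simp

omit [NeZero ℓ] [NeZero m] in
/-- The event of a fault carries the fault's cycle. -/
theorem Fault.ev_cyc (f : Fault ℓ m) : f.ev.cyc = f.cyc := by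
  cases f <;> rfl

omit [NeZero ℓ] [NeZero m] in
/-- Retagging commutes with taking the event. -/
theorem Fault.ev_retag (f : Fault ℓ m) (c' : ℕ) : (f.retag c').ev = f.ev.retag c' := by
  cases f <;> rfl

omit [NeZero ℓ] [NeZero m] in
/-- The cycle of a retagged fault. -/
@[simp] theorem Fault.cyc_retag (f : Fault ℓ m) (c' : ℕ) : (f.retag c').cyc = c' := by
  cases f <;> rfl

omit [NeZero ℓ] [NeZero m] in
/-- The location of a retagged fault determines the original location given the cycle. -/
theorem Fault.loc_retag_inj {f g : Fault ℓ m} (c' : ℕ) (h : (f.retag c').loc = (g.retag c').loc) (hc : f.cyc = g.cyc) :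
    f.loc = g.loc := by
  cases f <;> cases g <;> simp_all [Fault.retag, Fault.loc, Fault.cyc]

end Summit.Ventures.QEC.CircuitDistance
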